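import Literature.AlgebraicGeometry.CossartJannsenSaito2020.PolygonInvariants
import HarnessLib

/-!
# Cossart–Jannsen–Saito (LNM 2270), Def. 11.1 continued: the second-level invariants `β, γ⁻, γ⁺, ζ` and the vertices
# `v, w^±` of `Δ = fHull S` read on the generators (p. 146), and inequality (11.1) `β ≥ γ⁺ ≥ γ⁻` — PROVED LEMMAS

Companion of `PolygonInvariants.lean` (same source, same chunks p0145–p0146 of the held text
`book:cossart2020-desingularization-invariants-strategy-application-dimension-2` [`CossartJannsenSaito2020`]). For a finite
nonempty set `S` of generators and `Δ = fHull S = conv(S) + ℝ²_{≥0}`: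

* `isLeast_beta` / `beta_fHull`: `β(Δ) = min{s₂ | s ∈ S, s₁ = α(Δ)}` (p. 146 «`β(f,y,u) = inf{a₂/(nᵢ−|B|) | a₁/(nᵢ−|B|) = α(f,y,u),
  C_{i,A,B} ≠ 0}`»), attained; `vtx_mem`: the vertex `v(Δ) = (α, β)` is a generator (so it lies in `(1/n_N!)ℤ²` when the
  generators do — the mechanism of (11.4));
* `isLeast_gammaMinus` / `gammaMinus_fHull`, `isGreatest_gammaPlus` / `gammaPlus_fHull`: `γ^∓(Δ) = min / max {s₂ | s ∈ S,
  s₁ + s₂ = δ(Δ)}` (p. 146), attained (the `δ`-face is compact: its points lie in `conv(S)`);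
* `isLeast_zeta` / `zeta_fHull`: `ζ(Δ) = min{s₁ | s ∈ S, s₂ = ε(Δ)}`;
* **(11.1)** `gammaPlus_le_beta`, `gammaMinus_le_gammaPlus`; and the elementary `delta_le_alpha_add_beta`, `alpha_le_delta`,
  `epsilon_le_beta`.

All proofs are the separation lemma `minGens_inf'_le` of the companion file (a monotone affine functional `K·(L − min L) + M`)
plus bookkeeping. Pure convex geometry of `ℝ²`; nothing about schemes; no definitions, no named facts.
-/

noncomputable section

open Set
open scoped Pointwise

namespace Literature.AlgebraicGeometry.CossartJannsenSaito2020

namespace Polygon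

section Face

open scoped Classical


/-- **`β(fHull S) = min{s₂ | s ∈ S, s₁ = α(fHull S)}`** (p. 146, second formula); the infimum is attained at a generator.
[cite: CossartJannsenSaito2020, Def. 11.1] -/
theorem isLeast_beta (S : Finset (ℝ × ℝ)) (hS : S.Nonempty) :
    IsLeast {t : ℝ | (alpha (fHull (S : Set (ℝ × ℝ))), t) ∈ fHull (S : Set (ℝ × ℝ))}
      ((minGens S hS Prod.fst).inf' (minGens_nonempty S hS Prod.fst) Prod.snd) := by
  rw [alpha_fHull S hS]
  refine ⟨?_, fun t ht => ?_⟩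
  · obtain ⟨s₀, hs₀S, h1, h2⟩ := exists_minGens_eq S hS Prod.fst Prod.snd
    have he : (S.inf' hS Prod.fst, (minGens S hS Prod.fst).inf' (minGens_nonempty S hS Prod.fst) Prod.snd) = s₀ :=
      Prod.ext h1.symm h2.symm
    show (S.inf' hS Prod.fst, _) ∈ fHull (S : Set (ℝ × ℝ))
    rw [he]
    exact subset_fHull _ (Finset.mem_coe.mpr hs₀S)
  · exact minGens_inf'_le S hS (L := Prod.fst) (M := Prod.snd) (a := 1) (b := 0) (c := 0) (d := 1)
      (fun v => by ring) (fun v => by ring) zero_le_one le_rfl le_rfl zero_le_one ht le_rfl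

/-- **`β(fHull S)`** as a minimum over generators. [cite: CossartJannsenSaito2020, Def. 11.1] -/
theorem beta_fHull (S : Finset (ℝ × ℝ)) (hS : S.Nonempty) :
    beta (fHull (S : Set (ℝ × ℝ))) = (minGens S hS Prod.fst).inf' (minGens_nonempty S hS Prod.fst) Prod.snd :=
  (isLeast_beta S hS).csInf_eq

/-- **The vertex `v(fHull S) = (α, β)` is one of the generators** (hence lies in `(1/n_N!)ℤ²` when the generators do —
the shape of (11.4)). [cite: CossartJannsenSaito2020, Def. 11.1, (11.4)] -/
theorem vtx_mem (S : Finset (ℝ × ℝ)) (hS : S.Nonempty) : vtx (fHull (S : Set (ℝ × ℝ))) ∈ S := by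
  obtain ⟨s₀, hs₀S, h1, h2⟩ := exists_minGens_eq S hS Prod.fst Prod.snd
  have he : vtx (fHull (S : Set (ℝ × ℝ))) = s₀ := by
    refine Prod.ext ?_ ?_
    · show alpha _ = _; rw [alpha_fHull S hS]; exact h1.symm
    · show beta _ = _; rw [beta_fHull S hS]; exact h2.symm
  rw [he]; exact hs₀S

/-- **`γ⁻(fHull S) = min{s₂ | s ∈ S, s₁ + s₂ = δ}`** (p. 146); attained at a generator.
[cite: CossartJannsenSaito2020, Def. 11.1] -/
theorem isLeast_gammaMinus (S : Finset (ℝ × ℝ)) (hS : S.Nonempty) :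
    IsLeast {t : ℝ | (delta (fHull (S : Set (ℝ × ℝ))) - t, t) ∈ fHull (S : Set (ℝ × ℝ))}
      ((minGens S hS fun s => s.1 + s.2).inf' (minGens_nonempty S hS _) Prod.snd) := by
  rw [delta_fHull S hS]
  refine ⟨?_, fun t ht => ?_⟩
  · obtain ⟨s₀, hs₀S, h1, h2⟩ := exists_minGens_eq S hS (fun s => s.1 + s.2) Prod.snd
    have he : ((S.inf' hS fun s => s.1 + s.2) - (minGens S hS fun s => s.1 + s.2).inf' (minGens_nonempty S hS _) Prod.snd,
        (minGens S hS fun s => s.1 + s.2).inf' (minGens_nonempty S hS _) Prod.snd) = s₀ :=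
      Prod.ext (by simp only; rw [← h1, ← h2]; ring) h2.symm
    show (_, _) ∈ fHull (S : Set (ℝ × ℝ))
    rw [he]
    exact subset_fHull _ (Finset.mem_coe.mpr hs₀S)
  · exact minGens_inf'_le S hS (L := fun s => s.1 + s.2) (M := Prod.snd) (a := 1) (b := 1) (c := 0) (d := 1)
      (fun v => by ring) (fun v => by ring) zero_le_one zero_le_one le_rfl zero_le_one ht (by simp)

/-- **`γ⁻(fHull S)`** as a minimum over generators. [cite: CossartJannsenSaito2020, Def. 11.1] -/
theorem gammaMinus_fHull (S : Finset (ℝ × ℝ)) (hS : S.Nonempty) :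
    gammaMinus (fHull (S : Set (ℝ × ℝ))) =
      (minGens S hS fun s => s.1 + s.2).inf' (minGens_nonempty S hS _) Prod.snd :=
  (isLeast_gammaMinus S hS).csInf_eq

/-- **`ζ(fHull S) = min{s₁ | s ∈ S, s₂ = ε}`** (Def. 11.1); attained at a generator. [cite: CossartJannsenSaito2020, Def. 11.1] -/
theorem isLeast_zeta (S : Finset (ℝ × ℝ)) (hS : S.Nonempty) :
    IsLeast {t : ℝ | (t, epsilon (fHull (S : Set (ℝ × ℝ)))) ∈ fHull (S : Set (ℝ × ℝ))}
      ((minGens S hS Prod.snd).inf' (minGens_nonempty S hS Prod.snd) Prod.fst) := by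
  rw [epsilon_fHull S hS]
  refine ⟨?_, fun t ht => ?_⟩
  · obtain ⟨s₀, hs₀S, h1, h2⟩ := exists_minGens_eq S hS Prod.snd Prod.fst
    have he : ((minGens S hS Prod.snd).inf' (minGens_nonempty S hS Prod.snd) Prod.fst, S.inf' hS Prod.snd) = s₀ :=
      Prod.ext h2.symm h1.symm
    show (_, S.inf' hS Prod.snd) ∈ fHull (S : Set (ℝ × ℝ))
    rw [he]
    exact subset_fHull _ (Finset.mem_coe.mpr hs₀S)
  · exact minGens_inf'_le S hS (L := Prod.snd) (M := Prod.fst) (a := 0) (b := 1) (c := 1) (d := 0)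
      (fun v => by ring) (fun v => by ring) le_rfl zero_le_one zero_le_one le_rfl ht le_rfl

/-- **`ζ(fHull S)`** as a minimum over generators. [cite: CossartJannsenSaito2020, Def. 11.1] -/
theorem zeta_fHull (S : Finset (ℝ × ℝ)) (hS : S.Nonempty) :
    zeta (fHull (S : Set (ℝ × ℝ))) = (minGens S hS Prod.snd).inf' (minGens_nonempty S hS Prod.snd) Prod.fst :=
  (isLeast_zeta S hS).csInf_eq

/-- **`γ⁺(fHull S) = max{s₂ | s ∈ S, s₁ + s₂ = δ}`** (p. 146); the `δ`-face is compact (its points lie in `conv(S)`), and the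
supremum is attained at a generator. [cite: CossartJannsenSaito2020, Def. 11.1] -/
theorem isGreatest_gammaPlus (S : Finset (ℝ × ℝ)) (hS : S.Nonempty) :
    IsGreatest {t : ℝ | (delta (fHull (S : Set (ℝ × ℝ))) - t, t) ∈ fHull (S : Set (ℝ × ℝ))}
      ((minGens S hS fun s => s.1 + s.2).sup' (minGens_nonempty S hS _) Prod.snd) := by
  rw [delta_fHull S hS]
  set m := S.inf' hS fun s => s.1 + s.2 with hm
  set g := (minGens S hS fun s => s.1 + s.2).sup' (minGens_nonempty S hS _) Prod.snd with hg
  refine ⟨?_, fun t ht => ?_⟩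
  · obtain ⟨s₀, hs₀, hmax⟩ := (minGens S hS fun s => s.1 + s.2).exists_mem_eq_sup' (minGens_nonempty S hS _) Prod.snd
    obtain ⟨hs₀S, hs₀L⟩ := (mem_minGens_iff S hS).mp hs₀
    have he : (m - g, g) = s₀ :=
      Prod.ext (show m - g = s₀.1 by rw [hm, hg, hmax, ← hs₀L]; ring) (show g = s₀.2 by rw [hg, hmax])
    show (m - g, g) ∈ fHull (S : Set (ℝ × ℝ))
    rw [he]
    exact subset_fHull _ (Finset.mem_coe.mpr hs₀S)
  · -- `(m - t, t)` lies on the `δ`-face, hence in `conv(S)`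
    have hvc : (m - t, t) ∈ convexHull ℝ (S : Set (ℝ × ℝ)) :=
      mem_convexHull_of_mem_fHull_of_sum_le (c := m) (fun s hs => Finset.inf'_le _ (Finset.mem_coe.mp hs)) ht
        (by simp)
    -- the affine functional `v₂ - K (v₁ + v₂ - m)` is `≤ g` on the generators
    set K := ∑ s ∈ S, max 0 ((s.2 - g) / (s.1 + s.2 - m)) with hK
    have hK0 : 0 ≤ K := Finset.sum_nonneg fun s _ => le_max_left _ _
    have hgen : ∀ s ∈ (S : Set (ℝ × ℝ)), (-K) * s.1 + (1 - K) * s.2 ≤ g - K * m := by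
      intro s hs
      have hs' : s ∈ S := Finset.mem_coe.mp hs
      have hms : m ≤ s.1 + s.2 := Finset.inf'_le _ hs'
      rcases hms.eq_or_lt with heq | hlt
      · have hsF : s ∈ minGens S hS (fun s => s.1 + s.2) := (mem_minGens_iff S hS).mpr ⟨hs', heq.symm⟩
        have hsg : s.2 ≤ g := Finset.le_sup' Prod.snd hsF
        nlinarith
      · have hpos : 0 < s.1 + s.2 - m := sub_pos.mpr hlt
        have hKs : (s.2 - g) / (s.1 + s.2 - m) ≤ K :=
          (le_max_right _ _).trans
            (Finset.single_le_sum (f := fun s => max 0 ((s.2 - g) / (s.1 + s.2 - m))) (fun s _ => le_max_left _ _) hs')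
        have hKs' : s.2 - g ≤ K * (s.1 + s.2 - m) := by
          rw [div_le_iff₀ hpos] at hKs
          linarith
        nlinarith
    have h := lin_le_of_mem_convexHull hgen hvc
    simp only at h
    nlinarith

/-- **`γ⁺(fHull S)`** as a maximum over generators. [cite: CossartJannsenSaito2020, Def. 11.1] -/
theorem gammaPlus_fHull (S : Finset (ℝ × ℝ)) (hS : S.Nonempty) :
    gammaPlus (fHull (S : Set (ℝ × ℝ))) =
      (minGens S hS fun s => s.1 + s.2).sup' (minGens_nonempty S hS _) Prod.snd :=
  (isGreatest_gammaPlus S hS).csSup_eq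

/-! ### (11.1): `β ≥ γ⁺ ≥ γ⁻` -/

/-- **(11.1), first inequality: `γ⁺(Δ) ≤ β(Δ)`** for `Δ = fHull S` — a generator `s` on the `δ`-face has `s₁ ≥ α` and
`s₁ + s₂ = δ ≤ α + β` (the vertex `(α, β)` is a generator). [cite: CossartJannsenSaito2020, (11.1)] -/
theorem gammaPlus_le_beta (S : Finset (ℝ × ℝ)) (hS : S.Nonempty)
    : gammaPlus (fHull (S : Set (ℝ × ℝ))) ≤ beta (fHull (S : Set (ℝ × ℝ))) := by
  rw [gammaPlus_fHull S hS, beta_fHull S hS]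
  obtain ⟨v₀, hv₀S, h1, h2⟩ := exists_minGens_eq S hS Prod.fst Prod.snd
  have hδ : (S.inf' hS fun s => s.1 + s.2) ≤ v₀.1 + v₀.2 := Finset.inf'_le _ hv₀S
  refine Finset.sup'_le _ _ fun s hs => ?_
  obtain ⟨hsS, hsL⟩ := (mem_minGens_iff S hS).mp hs
  have hα : S.inf' hS Prod.fst ≤ s.1 := Finset.inf'_le _ hsS
  rw [← h2]
  linarith

/-- **(11.1), second inequality: `γ⁻(Δ) ≤ γ⁺(Δ)`** for `Δ = fHull S`. [cite: CossartJannsenSaito2020, (11.1)] -/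
theorem gammaMinus_le_gammaPlus (S : Finset (ℝ × ℝ)) (hS : S.Nonempty) :
    gammaMinus (fHull (S : Set (ℝ × ℝ))) ≤ gammaPlus (fHull (S : Set (ℝ × ℝ))) := by
  rw [gammaMinus_fHull S hS, gammaPlus_fHull S hS]
  obtain ⟨s, hs⟩ := minGens_nonempty S hS fun s => s.1 + s.2
  exact (Finset.inf'_le _ hs).trans (Finset.le_sup' _ hs)

/-- `δ ≤ α + β` for `Δ = fHull S` (the vertex `v` lies in `Δ`). [cite: CossartJannsenSaito2020, Def. 11.1] -/
theorem delta_le_alpha_add_beta (S : Finset (ℝ × ℝ)) (hS : S.Nonempty) :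
    delta (fHull (S : Set (ℝ × ℝ))) ≤ alpha (fHull (S : Set (ℝ × ℝ))) + beta (fHull (S : Set (ℝ × ℝ))) := by
  rw [delta_fHull S hS, alpha_fHull S hS, beta_fHull S hS]
  obtain ⟨v₀, hv₀S, h1, h2⟩ := exists_minGens_eq S hS Prod.fst Prod.snd
  rw [← h1, ← h2]
  exact Finset.inf'_le _ hv₀S

/-- `α ≤ δ` for `Δ = fHull S` with generators in `ℝ²_{≥0}`. [cite: CossartJannsenSaito2020, Def. 11.1] -/
theorem alpha_le_delta (S : Finset (ℝ × ℝ)) (hS : S.Nonempty) (h0 : ∀ s ∈ S, 0 ≤ s.2) :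
    alpha (fHull (S : Set (ℝ × ℝ))) ≤ delta (fHull (S : Set (ℝ × ℝ))) := by
  rw [delta_fHull S hS, alpha_fHull S hS]
  obtain ⟨s₀, hs₀, hmin⟩ := S.exists_mem_eq_inf' hS fun s => s.1 + s.2
  rw [hmin]
  exact (Finset.inf'_le _ hs₀).trans (le_add_of_nonneg_right (h0 s₀ hs₀))

/-- `ε ≤ β` for `Δ = fHull S`. [cite: CossartJannsenSaito2020, Def. 11.1] -/
theorem epsilon_le_beta (S : Finset (ℝ × ℝ)) (hS : S.Nonempty)
    : epsilon (fHull (S : Set (ℝ × ℝ))) ≤ beta (fHull (S : Set (ℝ × ℝ))) := by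
  rw [epsilon_fHull S hS, beta_fHull S hS]
  obtain ⟨v₀, hv₀S, h1, h2⟩ := exists_minGens_eq S hS Prod.fst Prod.snd
  rw [← h2]
  exact Finset.inf'_le _ hv₀S

end Face

end Polygon

end Literature.AlgebraicGeometry.CossartJannsenSaito2020

end
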